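import Summits.Parity.BatemanHorn.Theses.IsogenyRedei
import Summits.Parity.BatemanHorn.Theses.PolynomialMobius
import Summits.Parity.BatemanHorn.Theorems.IsogenyRedeiQuadraticOmegaParityLiouvilleQ1ToAP
import Summits.Parity.BatemanHorn.Theorems.IsogenyRedeiQuadraticOmegaParityLiouvilleAPToOmega
import Summits.Parity.BatemanHorn.Theorems.IsogenyRedeiQuadraticOmegaParityOmegaAPToLiouville

/-!
# `QuadraticOmegaParity` is the degree-2 case of Chowla's polynomial conjecture

Item stmt-Parity-11585 of route `IsogenyRedei` (`QuadraticOmegaParity`: for every irreducible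
quadratic `f ∈ ℤ[X]` with positive leading coefficient and every progression `n ≡ a (q)`,
`Σ_{n ≤ x, n ≡ a (q)} (−1)^{ω(f(n))} = o(x)`) is assembled here, from the three landed junctions
`liouvilleQ1_to_liouvilleAP`, `liouvilleAP_to_quadraticOmegaParity` and
`quadraticOmegaParity_to_liouvilleAP`, into its normal forms:

* `quadraticOmegaParity_iff_liouvilleAP` — equivalent to the Liouville form along every AP;
* `quadraticOmegaParity_iff_liouvilleQ1` — equivalent to the Liouville form at `q = 1`, i.e. to
  Chowla's conjecture (Chowla 1965; Teräväinen, Amer. J. Math. 2024, Conj. 1.2) for every irreducible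
  integer QUADRATIC: `Σ_{n ≤ x} λ(f(n)) = o(x)`;
* `quadraticOmegaParity_of_polyChowla` — in particular it follows from the crux `PolyChowla`
  (stmt-Parity-0872, all degrees `≥ 2`) of route `PolynomialMobius`, by restriction to degree `2`.

So the item is an open problem exactly as hard as quadratic Chowla, and is implied by the existing
item stmt-Parity-0872. No definitions; everything is a composition of landed theorems.
-/

namespace Summit.Parity.BatemanHorn.Theorems

open Filter Asymptotics Polynomial

/-- `QuadraticOmegaParity` (ω-parity of irreducible integer quadratics along every AP) is equivalent
to the same statement for Liouville's `λ` along every AP (composition of the landed junctions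
`quadraticOmegaParity_to_liouvilleAP` and `liouvilleAP_to_quadraticOmegaParity`). [folklore] -/
theorem quadraticOmegaParity_iff_liouvilleAP :
    Summit.Parity.BatemanHorn.Theses.IsogenyRedei.QuadraticOmegaParity ↔
    ∀ f : ℤ[X], Irreducible f → f.natDegree = 2 → 0 < f.leadingCoeff → ∀ q a : ℕ, 0 < q →
      (fun x : ℕ => ∑ n ∈ (Finset.Icc 1 x).filter (fun n : ℕ => n ≡ a [MOD q]),
        (ArithmeticFunction.liouville ((f.eval (n : ℤ)).toNat) : ℝ)) =o[atTop]
          fun x : ℕ => (x : ℝ) :=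
  ⟨quadraticOmegaParity_to_liouvilleAP, liouvilleAP_to_quadraticOmegaParity⟩

/-- Along the trivial progression (`q = 1`) the AP-restricted sum is the full sum. [folklore] -/
theorem filter_modEq_one_eq (a x : ℕ) :
    (Finset.Icc 1 x).filter (fun n : ℕ => n ≡ a [MOD 1]) = Finset.Icc 1 x :=
  Finset.filter_true_of_mem fun _ _ => Nat.modEq_one

/-- **Normal form.** `QuadraticOmegaParity` is equivalent to Chowla's conjecture (Liouville form,
`q = 1`) for irreducible integer quadratics with positive leading coefficient:
`Σ_{n ≤ x} λ(f(n)) = o(x)` for every such `f` (Chowla 1965; open — Teräväinen 2024, Conj. 1.2).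
Forward: the AP form at `q = 1`; backward: dilation (`liouvilleQ1_to_liouvilleAP`) and the
valuation-truncated squarefree sieve (`liouvilleAP_to_quadraticOmegaParity`). [folklore] -/
theorem quadraticOmegaParity_iff_liouvilleQ1 :
    Summit.Parity.BatemanHorn.Theses.IsogenyRedei.QuadraticOmegaParity ↔
    ∀ f : ℤ[X], Irreducible f → f.natDegree = 2 → 0 < f.leadingCoeff →
      (fun x : ℕ => ∑ n ∈ Finset.Icc 1 x,
        (ArithmeticFunction.liouville ((f.eval (n : ℤ)).toNat) : ℝ)) =o[atTop]
          fun x : ℕ => (x : ℝ) := by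
  refine ⟨fun H f hf hd hl => ?_, fun H => liouvilleAP_to_quadraticOmegaParity
    (liouvilleQ1_to_liouvilleAP H)⟩
  have h := quadraticOmegaParity_to_liouvilleAP H f hf hd hl 1 0 Nat.one_pos
  simpa only [filter_modEq_one_eq] using h

/-- **Upstream link.** The crux `PolyChowla` of route `PolynomialMobius` (stmt-Parity-0872:
Chowla's conjecture in Liouville form for every irreducible `f ∈ ℤ[X]` of degree `≥ 2` with
positive leading coefficient) implies `QuadraticOmegaParity` (stmt-Parity-11585), by restriction
to degree `2` and `quadraticOmegaParity_iff_liouvilleQ1`. [folklore] -/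
theorem quadraticOmegaParity_of_polyChowla
    (h : Summit.Parity.BatemanHorn.Theses.PolynomialMobius.PolyChowla) :
    Summit.Parity.BatemanHorn.Theses.IsogenyRedei.QuadraticOmegaParity :=
  quadraticOmegaParity_iff_liouvilleQ1.2 fun f hf hd hl => h f hf hd.ge hl

end Summit.Parity.BatemanHorn.Theorems
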